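/-
Copyright (c) 2026 the pub-hodgecm-mathlib formalisation cell (harness21).  Prover seat hodgecm-mathlib-K2Liu-p13 (g4), Track B «K2-LIT»,
#184♮ = hLiu418 = `stmt-HodgeConjecture-24832`; ROAD Φ (RULING «M-156n»), #41 TOP — a measure letter of the (β) END FILE: ★ (E3) `exists_eulerHead_intertwiningDelta`
quantifies over local Haar measures `ν_v` on `N_Δ(L⁺_v)` with `ν_v(K_{H,v} ∩ N_Δ(L⁺_v)) = 1` off `T`; this file SUPPLIES such a family at EVERY finite place (scale the Haar
measure by the positive finite mass of the compact open subgroup `K_{H,v} ∩ N_Δ(L⁺_v)`).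
THEOREMS ONLY (no `def`, no `instance`, no named-fact hypothesis, no `sorry`).
-/
import Summits.HodgeConjecture.HodgeConjecture.Theorems.K2LiuSiegelUnipotentHaarPinned   -- ★ Φ3b §1: `locallyCompactSpace∕secondCountableTopology_unipDeltaLoc`, `isCompact_inH_unipDeltaLoc`; ★ `isOpen_inH_unipDeltaLoc`
import HarnessLib

/-!
# Crux `HLiu418`, ROAD Φ, organ Φ8 (row G6): NORMALISED LOCAL HAAR MEASURES ON `N_Δ(L⁺_v)` — `ν_v(K_{H,v} ∩ N_Δ(L⁺_v)) = 1`

Cell `hodgecm-mathlib`, crux item hLiu418 = `stmt-HodgeConjecture-24832` (helper lane, count-neutral).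
* **`exists_isHaarMeasure_inH_eq_one`** — at every finite place `v` of `L⁺` there is a σ-finite Haar measure `ν_v` on `N_Δ(L⁺_v)` (★ `unipDeltaLoc`) giving the compact open
  subgroup `K_{H,v} ∩ N_Δ(L⁺_v)` (★ `inH`) mass `1`: `ν_v := (haar K)⁻¹ • haar` (`0 < haar K < ∞` since `K ∋ 1` is open and compact).
* **`exists_family_isHaarMeasure_inH_eq_one`** — a FAMILY `ν = (ν_v)_v` of such measures (choice), i.e. the letters `(νv) [∀ v, IsHaarMeasure] [∀ v, SigmaFinite] (hνK)`
  of ★ (E3) for `T = ∅` (hence for every `T`).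
Sources: [Tan1999, §2 (local measures normalised by `vol(N(𝒪_v)) = 1`)]; [Casselman1980, §3]; [BorelJacquet1979, §4.1].
HONEST LABEL.  Helper lemmas, count-neutral; `HC_CM` is proved only modulo the 7 printed citations (2 remaining named inputs:
hLiu418 = `stmt-HodgeConjecture-24832`, h413 = `stmt-HodgeConjecture-24833`) until rung 0 closes.
-/

set_option autoImplicit false
set_option linter.dupNamespace false -- the mandated namespace repeats `HodgeConjecture.HodgeConjecture`

noncomputable section

open scoped ENNReal NNReal
open NumberField IsDedekindDomain MeasureTheory Measure

namespace Summit.HodgeConjecture.HodgeConjecture.Cruxes.HLiu418.K2LiuUnipDeltaLocHaarNormalised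

open Literature.NumberTheory.Automorphic Literature.NumberTheory.GaloisRepresentations
open Literature.NumberTheory.GelbartRogawski1991 Literature.NumberTheory.GelbartRogawski1991.GRConstruction
open Literature.NumberTheory.K2Lit.SiegelDoubled
open Literature.Topology.Algebra.RestrictedProduct (inH)
open Summit.HodgeConjecture.HodgeConjecture.Cruxes.HLiu418.K2LiuSiegelUnipotentLocalDefs
open Summit.HodgeConjecture.HodgeConjecture.Cruxes.HLiu418.K2LiuSiegelUnipotentSplitAtDefs
open Summit.HodgeConjecture.HodgeConjecture.Cruxes.HLiu418.K2LiuSiegelUnipotentHaarPinned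

variable (L : Type) [Field L] [NumberField L] [IsCMField L]
variable {N M n : ℕ} (e : Fin N × Fin M ≃ Fin n)
  (dV : Fin N → L) (hdV : ∀ i, IsCMField.complexConj L (dV i) = dV i)
  (dW : Fin M → L) (hdW : ∀ i, IsCMField.complexConj L (dW i) = dW i)
  [∀ v : HeightOneSpectrum (𝓞 (Fp L)), MeasurableSpace ↥(unipDeltaLoc L e dV hdV dW hdW v)] [∀ v : HeightOneSpectrum (𝓞 (Fp L)), BorelSpace ↥(unipDeltaLoc L e dV hdV dW hdW v)]

/-- **A NORMALISED LOCAL HAAR MEASURE**: at every finite place `v` there is a σ-finite Haar measure `ν_v` on `N_Δ(L⁺_v)` with `ν_v(K_{H,v} ∩ N_Δ(L⁺_v)) = 1`.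
[cite: Tan1999, §2] [cite: Casselman1980, §3] [cite: BorelJacquet1979, §4.1] -/
theorem exists_isHaarMeasure_inH_eq_one (v : HeightOneSpectrum (𝓞 (Fp L))) :
    ∃ ν : Measure ↥(unipDeltaLoc L e dV hdV dW hdW v), ν.IsHaarMeasure ∧ SigmaFinite ν ∧
      ν (((inH (fun v => UnitaryGroup.localInt L (IsCMField.complexConj L) (n + n) (hermD L e dV hdV dW hdW) v) (fun v => unipDeltaLoc L e dV hdV dW hdW v) v) :
        Subgroup ↥(unipDeltaLoc L e dV hdV dW hdW v)) : Set ↥(unipDeltaLoc L e dV hdV dW hdW v)) = 1 := by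
  haveI := locallyCompactSpace_unipDeltaLoc L e dV hdV dW hdW v
  haveI := secondCountableTopology_unipDeltaLoc L e dV hdV dW hdW v
  set K : Set ↥(unipDeltaLoc L e dV hdV dW hdW v) := (((inH (fun v => UnitaryGroup.localInt L (IsCMField.complexConj L) (n + n) (hermD L e dV hdV dW hdW) v)
    (fun v => unipDeltaLoc L e dV hdV dW hdW v) v) : Subgroup ↥(unipDeltaLoc L e dV hdV dW hdW v)) : Set ↥(unipDeltaLoc L e dV hdV dW hdW v)) with hK
  have hKc : IsCompact K := isCompact_inH_unipDeltaLoc L e dV hdV dW hdW v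
  have hKo : IsOpen K := isOpen_inH_unipDeltaLoc L e dV hdV dW hdW v
  have hK1 : (1 : ↥(unipDeltaLoc L e dV hdV dW hdW v)) ∈ K := Subgroup.one_mem _
  set μ : Measure ↥(unipDeltaLoc L e dV hdV dW hdW v) := Measure.haar with hμ
  have hpos : μ K ≠ 0 := (hKo.measure_pos μ ⟨1, hK1⟩).ne'
  have htop : μ K ≠ ∞ := hKc.measure_lt_top.ne
  -- the normalising scalar as an `ℝ≥0` (so that `SigmaFinite (c • μ)` is an instance)
  set c : ℝ≥0 := (μ K).toNNReal⁻¹ with hc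
  have hc0 : c ≠ 0 := by
    rw [hc]
    exact inv_ne_zero (ENNReal.toNNReal_ne_zero.2 ⟨hpos, htop⟩)
  refine ⟨c • μ, ?_, inferInstance, ?_⟩
  · exact IsHaarMeasure.nnreal_smul μ hc0
  · rw [Measure.smul_apply, ENNReal.smul_def, smul_eq_mul, hc, ENNReal.coe_inv (ENNReal.toNNReal_ne_zero.2 ⟨hpos, htop⟩), ENNReal.coe_toNNReal htop,
      ENNReal.inv_mul_cancel hpos htop]

/-- **A NORMALISED FAMILY** `ν = (ν_v)_v`: Haar, σ-finite, `ν_v(K_{H,v} ∩ N_Δ(L⁺_v)) = 1` at EVERY `v` — the measure letters `(νv) [IsHaarMeasure] [SigmaFinite] (hνK)` of ★ (E3)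
`K2LiuBigCellEulerHead.exists_eulerHead_intertwiningDelta` for any exceptional set `T`. [cite: Tan1999, §2] [cite: BorelJacquet1979, §4.1] -/
theorem exists_family_isHaarMeasure_inH_eq_one :
    ∃ ν : ∀ v : HeightOneSpectrum (𝓞 (Fp L)), Measure ↥(unipDeltaLoc L e dV hdV dW hdW v),
      (∀ v, (ν v).IsHaarMeasure) ∧ (∀ v, SigmaFinite (ν v)) ∧
      ∀ v, ν v (((inH (fun v => UnitaryGroup.localInt L (IsCMField.complexConj L) (n + n) (hermD L e dV hdV dW hdW) v) (fun v => unipDeltaLoc L e dV hdV dW hdW v) v) :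
        Subgroup ↥(unipDeltaLoc L e dV hdV dW hdW v)) : Set ↥(unipDeltaLoc L e dV hdV dW hdW v)) = 1 := by
  choose ν hν hσ h1 using fun v => exists_isHaarMeasure_inH_eq_one L e dV hdV dW hdW v
  exact ⟨ν, hν, hσ, h1⟩

end Summit.HodgeConjecture.HodgeConjecture.Cruxes.HLiu418.K2LiuUnipDeltaLocHaarNormalised

end
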